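import Literature.MathematicalPhysics.QuantumFieldTheory.Balaban1983to89.B9Eq346OneSidedLegsAtCubesTorusL2
import Literature.MathematicalPhysics.QuantumFieldTheory.Balaban1983to89.B9Eq346MixedLegAtPinsL2

/-!
# `Balaban1983to89.B9Eq346OneSidedLegsModelsL2` — T. Bałaban, *Propagators for lattice gauge theories in a background field*, Commun. Math. Phys. **99**
# (1985) 389–434 [Balaban1985BackgroundPropagators] Cor 3.6 p. 408 ∕ (3.46) p. 398 ∕ (3.87)–(3.89) p. 409: ★★ **THE COORDINATE MODELS OF THE TWO
# LETTER-FREE `L²` LEGS `∇_{U,ν}G′_□M_{h_□}∇*_{U,μ}` AND `G′_□M_{h_□}∇*_{U,μ}` AND THEIR TORUS-LEVEL BLOCK BOUNDS** — the dictionary (pinned composites = scaled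
# coordinate models; the first-order model = block-scale multiplier after a scale-free model; `(geo9Y x).len = L^{lvl}·η`) and the `BlockBd`s of the models w.r.t. the
# torus site blocks, from the prequel `B9Eq346OneSidedLegsAtCubesTorusL2`; the member-level reading at the certificate's pins is the sequel `B9Eq346OneSidedLegsAtPinsL2`

statement-level skeleton of published theorems with citation tags; proofs where landed; nothing here is a claim about the Yang–Mills mass gap

THE PRINT.  (3.46) p. 398: *«‖h∇_UG′(U)∇\*_Uλ‖ ≤ B₀·1·e^{−δ₀d(y,y′)}‖h‖‖λ‖»*, *«‖hG′(U)∇\*_Uλ‖ ≤ B₀·Lʲη·…»*; Cor 3.6 p. 408 («constants independent of □»); (3.88)–(3.89)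
p. 409; p. 393 (`X·Y = tr XY`, the coordinates); [4] (2.46) p. 231, (2.51)–(2.54) pp. 232–233, Lemma 2.1 (2.61) p. 234.

WHY THIS FILE (cell `pub-ymgap`, Track A node N06 [B9], rows 18; width seat `pub-ymgap-dag-n06-w7`, g1, 2026-08-28).  With `B9RWSums346MixedFactorFromLegs` ∕
`B9RWSums346LetterL2FromMajorants` the certificate's displayed conjunct `FactorsL2Mixed37Dir (𝔬 x) (𝔡 x) (𝔩 x) 1 (H x) pM.θM p.δ₀ U` follows from displayed data, two
letter transposes and the two legs `hMix`, `hOne`; the sequel inhabits the two legs at the certificate's pins; THIS FILE carries the dictionary and the torus-level block bounds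
it needs (the pattern of this seat's `B9Eq346MixedLegAtPinsL2` §1–§2, now with the cut-off on ONE side and, for the first-order leg, print's scale factor `Lʲη`):
* §1 DICTIONARY — `mulOp_site_eq_coordOpK` (a real site multiplier on the carrier IS the coordinate model of `cutMulY`), `cutMulY_cutMulY_apply`, ★ `mixedLegR_model_eq`
  (`Dd ν ∘ (Gsq·M_h) ∘ Dsd μ = c_R • coordOpK (∇_νG′_cM_{h_c}∇\*_μ)`, units `η⁻¹·η²·η⁻¹`), ★ `oneLeg_model_eq` (`(Gsq·M_h) ∘ Dsd μ = (η·c_R) • coordOpK (G′_cM_{h_c}∇\*_μ)`),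
  `coordOpK_oneLeg_eq_mulOp_scaled` (the first-order model = a site multiplier `w` after the RESCALED model `w⁻¹·G′_cM_{h_c}∇\*_μ`; used with `w = L^{j(z)}`),
  `len_eq_pow_mul_etaS` (`(geo9Y x).len a = L^{lvl a}·η` at the members' `c_f = L^k`).
* §2 TORUS — `blockBd_torus_coordOpKH_mixedLegR` (kernel `√(20+320K)·e^{δ₀(1+1∕(2L))}·e^{−δ₁d_T}`), `hs_block_scaled_oneLeg_le` + `blockBd_torus_coordOpKH_oneLegScaled`
  (kernel `√(32+512K)·e^{δ₀(1+1∕(2L))}·e^{−δ₁d_T}` for the scaled model), `bl2_mulOp_blockConst` (a block-constant multiplier scales the block-`L²` size).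
HONEST SCOPE.  Dictionary + re-blocking over landed modules; the analytic input is dag-n06-w1's cube estimates (via the prequel); nothing of [B9] asserted beyond
kernel-checked parents; COUNT-NEUTRAL; N06 NOT discharged; K1⁹ NOT closed; nothing continuum ∕ OS ∕ mass gap ∕ Clay.  NEW file; nothing landed is modified.
-/

noncomputable section

namespace Literature.MathematicalPhysics.QuantumFieldTheory.Balaban1983to89.B9Eq346OneSidedLegsModelsL2

open Literature.MathematicalPhysics.QuantumFieldTheory.Balaban1983to89
open Node00 B6KLevelCensusIndexV1 B6Geom246MultiLevelBox B6MultiLevelTorusOperator B6GlobalChartV1 B9BackgroundsKLevelV1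
  B9Eq39Adjoint B9Thm311ReadingCoords B6Geom246MultiLevelTorus B9Eq346MixedLegAtCubesTorusL2 B9Eq346GradGpDivCoordsL2 B9Eq346GradGpDivAtPinsL2
  B9Eq346OneSidedLegsAtCubesTorusL2 B9Eq346MixedLegAtPinsL2
open Literature.MathematicalPhysics.QuantumFieldTheory.Balaban1983to89.B6Ineq2142KLevelV1 (lvl β)
open Literature.MathematicalPhysics.QuantumFieldTheory.Balaban1983to89.B9Thm314GpFlatMultiLevelTorus (consts_260_261)
open Literature.MathematicalPhysics.QuantumFieldTheory.Balaban1983to89.B6Lemma21Repaired (Ineq261With)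
open Literature.MathematicalPhysics.QuantumFieldTheory.Balaban1983to89.B9GeoNormsKLevelV1 (geo9K geo9K_len_kGeo)
open Literature.MathematicalPhysics.QuantumFieldTheory.Balaban1983to89.B9GeoLemma21KLevelV1 (one_le_Mh)
open Literature.MathematicalPhysics.QuantumFieldTheory.Balaban1983to89.B9Ineq349SiteComposite (cdSL cdsSL cdSL_apply cdsSL_apply etaS_pos)
open Literature.MathematicalPhysics.QuantumFieldTheory.Balaban1983to89.B9Thm39ReadingCoords (cR39 cR39_nonneg)
open Literature.MathematicalPhysics.QuantumFieldTheory.Balaban1983to89.B9CoReadingCoords (assembleK coordOpK coordOpK_apply coordOpK_comp)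
open Literature.MathematicalPhysics.QuantumFieldTheory.Balaban1983to89.B9CoReadingCoordsH (coordOpKH)
open Literature.MathematicalPhysics.QuantumFieldTheory.Balaban1983to89.B9CoReadingCoordsS (XSK blkSK sIK GcoS blkV1_site)
open Literature.MathematicalPhysics.QuantumFieldTheory.Balaban1983to89.B9CoReadingCoordsTranspose (TrIdx trBasis)
open Literature.MathematicalPhysics.QuantumFieldTheory.Balaban1983to89.B9Thm34Ext (toB6)
open Literature.MathematicalPhysics.QuantumFieldTheory.Balaban1983to89.B9SectDL2Decay (bsq bl2 BlockBd bsq_nonneg bl2_nonneg)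
open Literature.MathematicalPhysics.QuantumFieldTheory.Balaban1983to89.B9PinMembersKLevelV1 (MemberY geo9Y bg9Y reg335Y_iff)
open Literature.MathematicalPhysics.QuantumFieldTheory.Balaban1983to89.B9Thm37Sum (mulOp)
open Literature.MathematicalPhysics.QuantumFieldTheory.Balaban1983to89.B9Thm37Whole (Ops)
open Literature.MathematicalPhysics.QuantumFieldTheory.Balaban1983to89.B9RWSums346SecondDiffGp (DirOps37)
open Literature.MathematicalPhysics.QuantumFieldTheory.Balaban1983to89.B9Thm37CubeCoverCommutators (cutMulY cutMulY_apply hTY)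
open Literature.MathematicalPhysics.QuantumFieldTheory.Balaban1983to89.B6Partition118KLevelFineSizes (C1F)
open Literature.MathematicalPhysics.QuantumFieldTheory.Balaban1983to89.B6Cover236MultiLevelBlocks (cubes)
open Literature.MathematicalPhysics.QuantumFieldTheory.Balaban1983to89.B9WalkLettersCoordsS (cubeDomY SblkY hWalkY gsqcoS)
open Literature.MathematicalPhysics.QuantumFieldTheory.Balaban1983to89.Node00.OpsYLocalInverse (GsqY)
open Literature.MathematicalPhysics.QuantumFieldTheory.Balaban1983to89.Node00.OpsYSectDCoords (repr_assembleK coordOpKH_eq_coordOpK)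
open Literature.MathematicalPhysics.QuantumFieldTheory.Balaban1983to89.B9Thm311DeltaPrimePos (trIP_self_nonneg)
open scoped Matrix Matrix.Norms.L2Operator

variable {d ℓ : ℕ} {hd : 1 ≤ d + 1} {hL : Odd (ℓ + 1) ∧ 1 < ℓ + 1} {b₀ b₁ : ℝ} {Mstar : ℕ}
variable (x : MemberY d ℓ hd hL b₀ b₁ Mstar) {N : ℕ} {G : Subgroup (Matrix (Fin N) (Fin N) ℂ)ˣ}

/-! ## §1 The dictionary -/

section Dictionary

/-- **A REAL SITE MULTIPLIER ON THE COORDINATE CARRIER IS THE COORDINATE MODEL OF `cutMulY`** (a real scalar commutes with the trace coordinates; the cut-off case is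
`B9Eq346MixedLegAtPinsL2.mulOp_hWalkY_eq_coordOpK`). [cite: Balaban1985BackgroundPropagators, (3.87) p.409, p.397 (coordinates), dictionary] -/
theorem mulOp_site_eq_coordOpK (w : SiteY x.toKIdx → ℝ) :
    mulOp (fun p : XSK (TrIdx N) x.toKIdx => w p.1) = coordOpK (trBasis N) (fun _ : Fin (d + 1) => (cutMulY (𝔸 := Matrix (Fin N) (Fin N) ℂ) w).restrictScalars ℝ) := by
  apply LinearMap.ext; intro f; funext p
  rw [coordOpK_apply, LinearMap.restrictScalars_apply, cutMulY_apply, Complex.coe_smul, map_smul, Finsupp.smul_apply, smul_eq_mul, repr_assembleK]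
  rfl

/-- two real site multipliers compose pointwise. [cite: Balaban1985BackgroundPropagators, (3.87) p.409, bookkeeping] -/
theorem cutMulY_cutMulY_apply (w w' : SiteY x.toKIdx → ℝ) (Φ : SiteY x.toKIdx → Matrix (Fin N) (Fin N) ℂ) (z : SiteY x.toKIdx) :
    cutMulY w (cutMulY w' Φ) z = (((w z * w' z : ℝ)) : ℂ) • Φ z := by
  rw [cutMulY_apply, cutMulY_apply, smul_smul, Complex.ofReal_mul]

/-- ★ **THE PINNED COMPOSITE `Dd ν ∘ (Gsq · M_h) ∘ Dsd μ` IS `c_R • coordOpK (∇_{U,ν} G′_c(U) M_{h_c} ∇\*_{U,μ})`** (units `η⁻¹·η²·η⁻¹`).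
[cite: Balaban1985BackgroundPropagators, (3.87)–(3.88) p.409, (3.46) p.398, (3.42) p.397, dictionary] -/
theorem mixedLegR_model_eq (B : B9.Backgrounds) (cfg : B.Cfg → CfgY (Matrix (Fin N) (Fin N) ℂ) x.toKIdx) (U₁ : B.Cfg) (c : ↥(cubes x.toKIdx.D.toDomains)) (ν μ : Fin (d + 1)) :
    ((etaS x.toKIdx)⁻¹ • coordOpK (trBasis N) (fun _ : Fin (d + 1) => (cdSL x.toKIdx (cfg U₁) ν).restrictScalars ℝ)) ∘ₗ
        ((gsqcoS x (trBasis N) B cfg (parSymY x.toKIdx) c U₁ * mulOp (hWalkY x c)) ∘ₗ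
          ((etaS x.toKIdx)⁻¹ • coordOpK (trBasis N) (fun _ : Fin (d + 1) => (cdsSL x.toKIdx (cfg U₁) μ).restrictScalars ℝ)))
      = cR39 (trBasis N) • coordOpK (trBasis N) (fun _ : Fin (d + 1) =>
          (cdSL x.toKIdx (cfg U₁) ν ∘ₗ GsqY x.toKIdx (parSymY x.toKIdx) (cubeDomY x c) (cfg U₁) ∘ₗ cutMulY (hTY x.toKIdx c) ∘ₗ cdsSL x.toKIdx (cfg U₁) μ).restrictScalars ℝ) := by
  have hη : etaS x.toKIdx ≠ 0 := (etaS_pos x.toKIdx).ne'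
  rw [mulOp_hWalkY_eq_coordOpK]
  unfold gsqcoS GcoS
  simp only [Module.End.mul_eq_comp, LinearMap.smul_comp, LinearMap.comp_smul, LinearMap.comp_assoc, coordOpK_comp, restrictScalars_comp', smul_smul]
  congr 1
  field_simp

/-- ★ **THE PINNED COMPOSITE `(Gsq · M_h) ∘ Dsd μ` IS `(η·c_R) • coordOpK (G′_c(U) M_{h_c} ∇\*_{U,μ})`** (units `η²·η⁻¹` — one power of the lattice spacing survives: print's `Lʲη`).
[cite: Balaban1985BackgroundPropagators, (3.87)–(3.88) p.409, (3.46) p.398, (3.42) p.397, dictionary] -/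
theorem oneLeg_model_eq (B : B9.Backgrounds) (cfg : B.Cfg → CfgY (Matrix (Fin N) (Fin N) ℂ) x.toKIdx) (U₁ : B.Cfg) (c : ↥(cubes x.toKIdx.D.toDomains)) (μ : Fin (d + 1)) :
    (gsqcoS x (trBasis N) B cfg (parSymY x.toKIdx) c U₁ * mulOp (hWalkY x c)) ∘ₗ
          ((etaS x.toKIdx)⁻¹ • coordOpK (trBasis N) (fun _ : Fin (d + 1) => (cdsSL x.toKIdx (cfg U₁) μ).restrictScalars ℝ))
      = (etaS x.toKIdx * cR39 (trBasis N)) • coordOpK (trBasis N) (fun _ : Fin (d + 1) =>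
          (GsqY x.toKIdx (parSymY x.toKIdx) (cubeDomY x c) (cfg U₁) ∘ₗ cutMulY (hTY x.toKIdx c) ∘ₗ cdsSL x.toKIdx (cfg U₁) μ).restrictScalars ℝ) := by
  have hη : etaS x.toKIdx ≠ 0 := (etaS_pos x.toKIdx).ne'
  rw [mulOp_hWalkY_eq_coordOpK]
  unfold gsqcoS GcoS
  simp only [Module.End.mul_eq_comp, LinearMap.smul_comp, LinearMap.comp_smul, LinearMap.comp_assoc, coordOpK_comp, restrictScalars_comp', smul_smul]
  congr 1
  field_simp

/-- **THE FIRST-ORDER MODEL IS A (NON-VANISHING REAL) SITE MULTIPLIER AFTER THE RESCALED MODEL**: `coordOpK (G′_cM_{h_c}∇\*_μ) = M_w ∘ coordOpK (w⁻¹·G′_cM_{h_c}∇\*_μ)`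
(used with `w = L^{j(z)}`, the block scale). [cite: Balaban1985BackgroundPropagators, (3.46) p.398 + (3.41) p.397, dictionary] -/
theorem coordOpK_oneLeg_eq_mulOp_scaled (U : CfgY (Matrix (Fin N) (Fin N) ℂ) x.toKIdx) (c : ↥(cubes x.toKIdx.D.toDomains)) (μ : Fin (d + 1))
    (w : SiteY x.toKIdx → ℝ) (hw0 : ∀ z, w z ≠ 0) :
    coordOpK (trBasis N) (fun _ : Fin (d + 1) =>
        (GsqY x.toKIdx (parSymY x.toKIdx) (cubeDomY x c) U ∘ₗ cutMulY (hTY x.toKIdx c) ∘ₗ cdsSL x.toKIdx U μ).restrictScalars ℝ)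
      = mulOp (fun p : XSK (TrIdx N) x.toKIdx => w p.1) ∘ₗ coordOpK (trBasis N) (fun _ : Fin (d + 1) =>
        (cutMulY (fun z => (w z)⁻¹) ∘ₗ GsqY x.toKIdx (parSymY x.toKIdx) (cubeDomY x c) U ∘ₗ cutMulY (hTY x.toKIdx c) ∘ₗ cdsSL x.toKIdx U μ).restrictScalars ℝ) := by
  rw [mulOp_site_eq_coordOpK, coordOpK_comp]
  congr 1; funext ν'
  rw [← restrictScalars_comp']
  congr 1
  apply LinearMap.ext; intro Φ; funext z
  simp only [LinearMap.comp_apply]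
  rw [cutMulY_cutMulY_apply, mul_inv_cancel₀ (hw0 z), Complex.ofReal_one, one_smul]

/-- **print's `Lʲη` at the members**: `(geo9Y x).len a = L^{lvl a} · η` (`c_f = L^k`, `η = L^{−k}`). [cite: Balaban1985BackgroundPropagators, (3.41) p.397 («Lʲη»); Balaban1984PropagatorsII, (2.1) p.224] -/
theorem len_eq_pow_mul_etaS (a : (geo9Y x).Site) :
    (geo9Y x).len a = (((ℓ + 1) ^ (lvl x.hN x.D x.hk a) : ℕ) : ℝ) * etaS x.toKIdx := by
  have h1 : (geo9Y x).len a = (((ℓ + 1 : ℕ) : ℝ)) ^ (lvl x.hN x.D x.hk a) / |x.toKIdx.cf| := by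
    show (geo9K x.toKIdx).len a = _
    rw [geo9K_len_kGeo]; exact len_eq x.toKIdx a
  have hcf : x.toKIdx.cf = (((ℓ + 1 : ℕ) : ℝ)) ^ x.toKIdx.k := x.hcfk
  have hpos : (0 : ℝ) < (((ℓ + 1 : ℕ) : ℝ)) ^ x.toKIdx.k := by positivity
  have hη : etaS x.toKIdx = ((((ℓ + 1) ^ x.toKIdx.k : ℕ) : ℝ))⁻¹ := rfl
  rw [h1, hcf, abs_of_pos hpos, hη, div_eq_mul_inv]
  push_cast
  ring

end Dictionary

/-! ## §2 The torus-level block bounds of the two models -/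

section Torus

/-- a site multiplier CONSTANT ON THE TARGET BLOCKS scales the block-`L²` size: `‖1_{Δ(a)}(w·F)‖ = |φ(a)|·‖1_{Δ(a)}F‖` for `w = φ ∘ blk`. [cite: Balaban1984PropagatorsII, (2.51) p.232, bookkeeping] -/
theorem bl2_mulOp_blockConst {G' : B6.Geometry} {X₁ : Type} [Fintype X₁] (blk : X₁ → G'.Site) (φ : G'.Site → ℝ) (a : G'.Site) (F : X₁ → ℝ) :
    bl2 (g := G') blk a (fun p => φ (blk p) * F p) = |φ a| * bl2 (g := G') blk a F := by
  classical
  have h : bsq (g := G') blk a (fun p => φ (blk p) * F p) = φ a ^ 2 * bsq (g := G') blk a F := by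
    unfold bsq
    rw [Finset.mul_sum]
    refine Finset.sum_congr rfl fun p _ => ?_
    split_ifs with hp
    · dsimp only; rw [hp]; ring
    · ring
  unfold bl2
  rw [h, Real.sqrt_mul' _ (bsq_nonneg _ _ _), Real.sqrt_sq_eq_abs]

open Classical in
/-- the torus-level block bound of `coordOpKH (trBasis N) (fun _ => ∇_ν G′_c M_{h_c} ∇\*_μ)` w.r.t. the site block map along `Prod.fst`, from the prequel's HS bound:
kernel `√(20+320K)·e^{δ₀(1+1∕(2L))}·e^{−δ₁·d_T}`, `δ₁ = δ₀∕(2L)`, `δ₀ = 1∕(4(d+2))`, `K = (5C₁∕8)²L⁴`.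
[cite: Balaban1985BackgroundPropagators, Cor 3.6 p.408, (3.46) p.398; Balaban1984PropagatorsII, (2.46) p.231, (2.54) p.233; Agmon1982, Ch.1, Thm 1.5] -/
theorem blockBd_torus_coordOpKH_mixedLegR [Nonempty (Fin N)] (hG : G ≤ B7Prop2Explicit.unitaryUnits (Matrix (Fin N) (Fin N) ℂ))
    {U : CfgY (Matrix (Fin N) (Fin N) ℂ) x.toKIdx} {c₀ α₀ : ℝ} (hC0 : 0 ≤ c₀ * (geo9Y x).M * α₀) (hC1 : c₀ * (geo9Y x).M * α₀ * ((d : ℝ) + 1) ≤ 1 / 16)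
    (hreg : (bg9K (Matrix (Fin N) (Fin N) ℂ) G x.toKIdx).Reg335 c₀ α₀ U) (c : ↥(cubes x.toKIdx.D.toDomains)) (ν μ : Fin (d + 1)) :
    BlockBd (g := geomT x.toKIdx.D) (fun p : XSK (TrIdx N) x.toKIdx => blkOf x.toKIdx.D.toDomains p.1) (fun p : XSK (TrIdx N) x.toKIdx => blkOf x.toKIdx.D.toDomains p.1)
      (coordOpKH (trBasis N) (fun _ : Fin (d + 1) =>
        (cdSL x.toKIdx U ν ∘ₗ GsqY x.toKIdx (parSymY x.toKIdx) (cubeDomY x c) U ∘ₗ cutMulY (hTY x.toKIdx c) ∘ₗ cdsSL x.toKIdx U μ).restrictScalars ℝ))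
      (fun t s => Real.sqrt (20 + 320 * ((5 * C1F d ℓ / 8) ^ 2 * (((ℓ + 1 : ℕ) : ℝ)) ^ 4))
        * Real.exp ((1 / (4 * ((d : ℝ) + 2))) * (1 + 1 / (2 * ((ℓ + 1 : ℕ) : ℝ))))
        * Real.exp (-((1 / (4 * ((d : ℝ) + 2))) / (2 * ((ℓ + 1 : ℕ) : ℝ)) * (geomT x.toKIdx.D).dist t s))) := by
  set δ₀ : ℝ := 1 / (4 * ((d : ℝ) + 2)) with hδ₀
  set L2 : ℝ := 2 * ((ℓ + 1 : ℕ) : ℝ) with hL2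
  set CM : ℝ := 20 + 320 * ((5 * C1F d ℓ / 8) ^ 2 * (((ℓ + 1 : ℕ) : ℝ)) ^ 4) with hCM
  have hCM0 : 0 ≤ CM := by positivity
  have hL2pos : 0 < L2 := by rw [hL2]; positivity
  have hK : BlockBd (g := geomT x.toKIdx.D) (fun p : XSK (TrIdx N) x.toKIdx => blkOf x.toKIdx.D.toDomains p.1) (fun p : XSK (TrIdx N) x.toKIdx => blkOf x.toKIdx.D.toDomains p.1)
      (coordOpKH (trBasis N) (fun _ : Fin (d + 1) =>
        (cdSL x.toKIdx U ν ∘ₗ GsqY x.toKIdx (parSymY x.toKIdx) (cubeDomY x c) U ∘ₗ cutMulY (hTY x.toKIdx c) ∘ₗ cdsSL x.toKIdx U μ).restrictScalars ℝ))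
      (fun t s => Real.sqrt CM * (Real.exp (δ₀ * (((((bondT x.toKIdx.D).dist t s : ℝ)) - 1) / L2 - 1)))⁻¹) := by
    refine blockBd_fst_coordOpKH_of_hs (fun t s => by positivity) fun Λ t s hΛ => ?_
    have hall := hs_block_cdS_GsqY_hTY_cdsS_le x hG (U := U) hC0 hC1 hreg c μ s t hΛ
    -- one direction `ν` out of the sum over all directions
    have hone : ∑ z ∈ Finset.univ.filter (fun z => blkOf x.toKIdx.D.toDomains z = t),
        ∑ a, ∑ b, ‖cdS x.toKIdx U ν (GsqY x.toKIdx (parSymY x.toKIdx) (cubeDomY x c) U (cutMulY (hTY x.toKIdx c) (cdsS x.toKIdx U μ Λ))) z a b‖ ^ 2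
        ≤ ∑ z ∈ Finset.univ.filter (fun z => blkOf x.toKIdx.D.toDomains z = t),
          ∑ ν' : Fin (d + 1), ∑ a, ∑ b, ‖cdS x.toKIdx U ν' (GsqY x.toKIdx (parSymY x.toKIdx) (cubeDomY x c) U (cutMulY (hTY x.toKIdx c) (cdsS x.toKIdx U μ Λ))) z a b‖ ^ 2 :=
      Finset.sum_le_sum fun z _ => Finset.single_le_sum (f := fun ν' : Fin (d + 1) =>
        ∑ a, ∑ b, ‖cdS x.toKIdx U ν' (GsqY x.toKIdx (parSymY x.toKIdx) (cubeDomY x c) U (cutMulY (hTY x.toKIdx c) (cdsS x.toKIdx U μ Λ))) z a b‖ ^ 2)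
        (fun ν' _ => by positivity) (Finset.mem_univ ν)
    have h := hone.trans hall
    have hK2 : (Real.sqrt CM * (Real.exp (δ₀ * (((((bondT x.toKIdx.D).dist t s : ℝ)) - 1) / L2 - 1)))⁻¹) ^ 2
        = CM / Real.exp (δ₀ * (((((bondT x.toKIdx.D).dist t s : ℝ)) - 1) / L2 - 1)) ^ 2 := by
      rw [mul_pow, Real.sq_sqrt hCM0, inv_pow]
      exact (div_eq_mul_inv _ _).symm
    rw [hK2, ← B9Ineq369CurvatureSmallAtLettersY.trIP_one_self_eq, Finset.sum_ite, Finset.sum_const_zero, add_zero]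
    convert h using 3
    all_goals first | rfl | skip
    rename_i _ z z' hz
    have hzz : z = z' := eq_of_heq hz
    subst hzz
    rfl
  refine hK.mono fun t s => le_of_eq ?_
  have hdist : (geomT x.toKIdx.D).dist t s = (((bondT x.toKIdx.D).dist t s : ℝ)) := rfl
  rw [hdist, ← Real.exp_neg, mul_assoc (Real.sqrt CM), ← Real.exp_add]
  congr 2
  rw [hL2]
  field_simp
  ring

open Classical in
/-- the HS block sums of the SCALED first-order field `L^{−j(z)}·(G′_cM_{h_c}∇\*_μλ)(z)` are scale-free: `≤ (32+512K)·‖λ‖²₁ ∕ (e^{δ₀((d_T(t,s)−1)∕(2L)−1)})²`.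
[cite: Balaban1985BackgroundPropagators, Cor 3.6 p.408, (3.46) p.398, (3.41) p.397; Agmon1982, Ch.1, Thm 1.5] -/
theorem hs_block_scaled_oneLeg_le [Nonempty (Fin N)] (hG : G ≤ B7Prop2Explicit.unitaryUnits (Matrix (Fin N) (Fin N) ℂ))
    {U : CfgY (Matrix (Fin N) (Fin N) ℂ) x.toKIdx} {c₀ α₀ : ℝ} (hC0 : 0 ≤ c₀ * (geo9Y x).M * α₀) (hC1 : c₀ * (geo9Y x).M * α₀ * ((d : ℝ) + 1) ≤ 1 / 16)
    (hreg : (bg9K (Matrix (Fin N) (Fin N) ℂ) G x.toKIdx).Reg335 c₀ α₀ U) (c : ↥(cubes x.toKIdx.D.toDomains)) (μ : Fin (d + 1)) (s t : BlkY x.toKIdx)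
    (w : SiteY x.toKIdx → ℝ) (hw : ∀ z, w z = (((ℓ + 1) ^ (blkOf x.toKIdx.D.toDomains z).1.1 : ℕ) : ℝ))
    {Λ : SiteY x.toKIdx → Matrix (Fin N) (Fin N) ℂ} (hΛ : ∀ z, blkOf x.toKIdx.D.toDomains z ≠ s → Λ z = 0) :
    ∑ z ∈ Finset.univ.filter (fun z => blkOf x.toKIdx.D.toDomains z = t),
        ∑ a, ∑ b, ‖cutMulY (fun z => (w z)⁻¹) (GsqY x.toKIdx (parSymY x.toKIdx) (cubeDomY x c) U (cutMulY (hTY x.toKIdx c) (cdsS x.toKIdx U μ Λ))) z a b‖ ^ 2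
      ≤ (32 + 512 * ((5 * C1F d ℓ / 8) ^ 2 * (((ℓ + 1 : ℕ) : ℝ)) ^ 4))
          / Real.exp ((1 / (4 * ((d : ℝ) + 2))) * (((((bondT x.toKIdx.D).dist t s : ℝ)) - 1) / (2 * ((ℓ + 1 : ℕ) : ℝ)) - 1)) ^ 2
        * trIP (fun _ => (1 : ℝ)) Λ Λ := by
  set Tt : ℝ := ((((ℓ + 1) ^ t.1.1 : ℕ) : ℝ)) ^ 2 with hTt
  have hTt0 : 0 < Tt := by positivity
  -- on `Δ(t)` the scale is the constant `L^{lev t}`: the HS sums pick up the factor `(L^{lev t})⁻²`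
  have hterm : ∀ z ∈ Finset.univ.filter (fun z => blkOf x.toKIdx.D.toDomains z = t),
      ∑ a, ∑ b, ‖cutMulY (fun z => (w z)⁻¹) (GsqY x.toKIdx (parSymY x.toKIdx) (cubeDomY x c) U (cutMulY (hTY x.toKIdx c) (cdsS x.toKIdx U μ Λ))) z a b‖ ^ 2
        = Tt⁻¹ * ∑ a, ∑ b, ‖GsqY x.toKIdx (parSymY x.toKIdx) (cubeDomY x c) U (cutMulY (hTY x.toKIdx c) (cdsS x.toKIdx U μ Λ)) z a b‖ ^ 2 := by
    intro z hz
    rw [Finset.mem_filter] at hz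
    have hscl : w z = (((ℓ + 1) ^ t.1.1 : ℕ) : ℝ) := by rw [hw z, hz.2]
    rw [cutMulY_apply, hscl, Finset.mul_sum]
    refine Finset.sum_congr rfl fun a _ => ?_
    rw [Finset.mul_sum]
    refine Finset.sum_congr rfl fun b _ => ?_
    rw [Matrix.smul_apply, norm_smul, mul_pow, Complex.norm_real, Real.norm_eq_abs, abs_inv, inv_pow, sq_abs, hTt]
  rw [Finset.sum_congr rfl hterm, ← Finset.mul_sum]
  have h := hs_block_GsqY_hTY_cdsS_le x hG (U := U) hC0 hC1 hreg c μ s t hΛ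
  rw [← hTt] at h
  have hQ0 : 0 ≤ trIP (fun _ => (1 : ℝ)) Λ Λ := trIP_self_nonneg _ (fun _ => one_pos) Λ
  calc Tt⁻¹ * ∑ z ∈ Finset.univ.filter (fun z => blkOf x.toKIdx.D.toDomains z = t),
          ∑ a, ∑ b, ‖GsqY x.toKIdx (parSymY x.toKIdx) (cubeDomY x c) U (cutMulY (hTY x.toKIdx c) (cdsS x.toKIdx U μ Λ)) z a b‖ ^ 2
      ≤ Tt⁻¹ * ((32 + 512 * ((5 * C1F d ℓ / 8) ^ 2 * (((ℓ + 1 : ℕ) : ℝ)) ^ 4)) * Tt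
          / Real.exp ((1 / (4 * ((d : ℝ) + 2))) * (((((bondT x.toKIdx.D).dist t s : ℝ)) - 1) / (2 * ((ℓ + 1 : ℕ) : ℝ)) - 1)) ^ 2 * trIP (fun _ => (1 : ℝ)) Λ Λ) :=
        mul_le_mul_of_nonneg_left h (inv_nonneg.mpr hTt0.le)
    _ = _ := by field_simp

open Classical in
/-- the torus-level block bound of the SCALED first-order model `coordOpKH (trBasis N) (fun _ => L^{−j}·G′_cM_{h_c}∇\*_μ)`: kernel `√(32+512K)·e^{δ₀(1+1∕(2L))}·e^{−δ₁·d_T}`.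
[cite: Balaban1985BackgroundPropagators, Cor 3.6 p.408, (3.46) p.398; Balaban1984PropagatorsII, (2.46) p.231, (2.54) p.233; Agmon1982, Ch.1, Thm 1.5] -/
theorem blockBd_torus_coordOpKH_oneLegScaled [Nonempty (Fin N)] (hG : G ≤ B7Prop2Explicit.unitaryUnits (Matrix (Fin N) (Fin N) ℂ))
    {U : CfgY (Matrix (Fin N) (Fin N) ℂ) x.toKIdx} {c₀ α₀ : ℝ} (hC0 : 0 ≤ c₀ * (geo9Y x).M * α₀) (hC1 : c₀ * (geo9Y x).M * α₀ * ((d : ℝ) + 1) ≤ 1 / 16)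
    (hreg : (bg9K (Matrix (Fin N) (Fin N) ℂ) G x.toKIdx).Reg335 c₀ α₀ U) (c : ↥(cubes x.toKIdx.D.toDomains)) (μ : Fin (d + 1))
    (w : SiteY x.toKIdx → ℝ) (hw : ∀ z, w z = (((ℓ + 1) ^ (blkOf x.toKIdx.D.toDomains z).1.1 : ℕ) : ℝ)) :
    BlockBd (g := geomT x.toKIdx.D) (fun p : XSK (TrIdx N) x.toKIdx => blkOf x.toKIdx.D.toDomains p.1) (fun p : XSK (TrIdx N) x.toKIdx => blkOf x.toKIdx.D.toDomains p.1)
      (coordOpKH (trBasis N) (fun _ : Fin (d + 1) =>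
        (cutMulY (fun z => (w z)⁻¹) ∘ₗ GsqY x.toKIdx (parSymY x.toKIdx) (cubeDomY x c) U ∘ₗ cutMulY (hTY x.toKIdx c) ∘ₗ cdsSL x.toKIdx U μ).restrictScalars ℝ))
      (fun t s => Real.sqrt (32 + 512 * ((5 * C1F d ℓ / 8) ^ 2 * (((ℓ + 1 : ℕ) : ℝ)) ^ 4))
        * Real.exp ((1 / (4 * ((d : ℝ) + 2))) * (1 + 1 / (2 * ((ℓ + 1 : ℕ) : ℝ))))
        * Real.exp (-((1 / (4 * ((d : ℝ) + 2))) / (2 * ((ℓ + 1 : ℕ) : ℝ)) * (geomT x.toKIdx.D).dist t s))) := by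
  set δ₀ : ℝ := 1 / (4 * ((d : ℝ) + 2)) with hδ₀
  set L2 : ℝ := 2 * ((ℓ + 1 : ℕ) : ℝ) with hL2
  set CM : ℝ := 32 + 512 * ((5 * C1F d ℓ / 8) ^ 2 * (((ℓ + 1 : ℕ) : ℝ)) ^ 4) with hCM
  have hCM0 : 0 ≤ CM := by positivity
  have hL2pos : 0 < L2 := by rw [hL2]; positivity
  have hK : BlockBd (g := geomT x.toKIdx.D) (fun p : XSK (TrIdx N) x.toKIdx => blkOf x.toKIdx.D.toDomains p.1) (fun p : XSK (TrIdx N) x.toKIdx => blkOf x.toKIdx.D.toDomains p.1)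
      (coordOpKH (trBasis N) (fun _ : Fin (d + 1) =>
        (cutMulY (fun z => (w z)⁻¹) ∘ₗ GsqY x.toKIdx (parSymY x.toKIdx) (cubeDomY x c) U ∘ₗ cutMulY (hTY x.toKIdx c) ∘ₗ cdsSL x.toKIdx U μ).restrictScalars ℝ))
      (fun t s => Real.sqrt CM * (Real.exp (δ₀ * (((((bondT x.toKIdx.D).dist t s : ℝ)) - 1) / L2 - 1)))⁻¹) := by
    refine blockBd_fst_coordOpKH_of_hs (fun t s => by positivity) fun Λ t s hΛ => ?_
    have h := hs_block_scaled_oneLeg_le x hG (U := U) hC0 hC1 hreg c μ s t w hw hΛ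
    have hK2 : (Real.sqrt CM * (Real.exp (δ₀ * (((((bondT x.toKIdx.D).dist t s : ℝ)) - 1) / L2 - 1)))⁻¹) ^ 2
        = CM / Real.exp (δ₀ * (((((bondT x.toKIdx.D).dist t s : ℝ)) - 1) / L2 - 1)) ^ 2 := by
      rw [mul_pow, Real.sq_sqrt hCM0, inv_pow]
      exact (div_eq_mul_inv _ _).symm
    rw [hK2, ← B9Ineq369CurvatureSmallAtLettersY.trIP_one_self_eq, Finset.sum_ite, Finset.sum_const_zero, add_zero]
    convert h using 3
    all_goals first | rfl | skip
    rename_i _ z z' hz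
    have hzz : z = z' := eq_of_heq hz
    subst hzz
    rfl
  refine hK.mono fun t s => le_of_eq ?_
  have hdist : (geomT x.toKIdx.D).dist t s = (((bondT x.toKIdx.D).dist t s : ℝ)) := rfl
  rw [hdist, ← Real.exp_neg, mul_assoc (Real.sqrt CM), ← Real.exp_add]
  congr 2
  rw [hL2]
  field_simp
  ring

end Torus

end Literature.MathematicalPhysics.QuantumFieldTheory.Balaban1983to89.B9Eq346OneSidedLegsModelsL2

end
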